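/-
Copyright (c) 2026. All rights reserved.
Released under Apache 2.0 license as described in the file LICENSE.
-/
import Literature.Topology.FourManifolds.MorseTopHandleDatum
import Literature.AlgebraicTopology.SingularHomology.SphereCylinderCohomology
import Literature.AlgebraicTopology.SingularHomology.KroneckerDualMap
import Literature.AlgebraicTopology.SingularHomology.CohomologyHomotopyInvariance
import Literature.AlgebraicTopology.SingularHomology.ClopenAdditivityCohomology
import Literature.AlgebraicTopology.SingularHomology.LocallyFlatComplement
import Literature.AlgebraicTopology.SingularHomology.CellsAttachmentEuler
import Literature.Geometry.Manifold.WhitneyApproximation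
import Literature.Geometry.Manifold.ModelChange
import Literature.Topology.FourManifolds.MorseExistence
import Literature.Topology.FourManifolds.NiceMorseFunctionsProofs
import Literature.Topology.FourManifolds.MorseCountClosed
import Literature.Topology.FourManifolds.GradientLikeExistence
import Literature.Topology.FourManifolds.MorseHomologyVanishing

/-!
# Natural endomorphisms of `Hᵏ(-; F)` on smooth manifolds are scalars

Let `E` be a finite-dimensional real normed space, `F` a field and `k : ℕ`. A **natural
endomorphism of `Hᵏ(-; F)` on `E`-manifolds** (`NaturalCohomologyEndo E F k`) assigns to every
Hausdorff σ-compact `C^∞` manifold `M : Type` charted on `E` an `F`-linear map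
`ψ_M : Hᵏ(M; F) → Hᵏ(M; F)` with `ψ_M ∘ f^* = f^* ∘ ψ_N` for every `C^∞` map `f : M → N`.

**Theorem** (`NaturalCohomologyEndo.exists_eq_smul`). There is a scalar `r : F` with
`ψ_M = r • id` for every *compact* `E`-manifold `M`.

This is the topological rigidity behind the independence of the Hodge `(p, q)`-types of the
comparison isomorphism `H_dR ⊗ ℂ ≅ H_B ⊗ ℂ` (`Literature.AlgebraicGeometry.HodgeTheory`): two
natural de Rham comparison families differ by a natural automorphism of `Hᵏ(-; ℂ)`.

## Proof (Morse theory; Milnor 1963/1965, Hatcher 2002)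

Write `m = dim E`.
* `k = 0`: `H⁰(E; F)` is a line, so `ψ_E = r`; for a path component `P ⊆ M` a constant map
  `E → P` is injective on `H⁰` (it is onto on `H₀`), so `ψ_P = r`; and `H⁰(M) ↪ ∏_P H⁰(P)`
  (clopen additivity).
* `k ≥ 1`, `m = 0` or `k > m`: `Hₖ(M; F) = 0` (discrete space, resp. Morse functions have indices
  `≤ m`, Milnor 1963 §5), hence `Hᵏ(M; F) = 0`.
* `1 ≤ k ≤ m`: let `Q = Sᵏ × ℝ^{m-k}` re-charted on `E`; `Hᵏ(Q; F)` is a line, so `ψ_Q = r`.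
  Re-chart `M` on `ℝᵐ`, choose a nice Morse function `g` and a gradient-like field (Milnor 1965,
  Thm. 4.8, Lemma 3.2) and let `U = {g < cut_{k+1}}` (an open subset of `M`, hence an
  `E`-manifold). By `Literature.Topology.FourManifolds.Cobordism.IsNiceMorseFunction.exists_map_collapse_ne_zero`
  every non-zero `σ ∈ Hₖ(U; F)` is detected by the Pontryagin–Thom collapse
  `γ_p : U → OnePoint ℝᵏ ≅ Sᵏ` of the normal coordinate of some right-hand disc; smoothing
  `γ_p` (Whitney approximation) and following with the zero section gives a `C^∞` map
  `G_p : U → Q` with `(G_p)_* σ ≠ 0`. By Kronecker duality over the field `F` and the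
  finite-dimensionality of `Hₖ(U; F)`, the classes `G_p^* v` span `Hᵏ(U; F)`; on them
  `ψ_U = r` by naturality. Finally `Hᵏ(M) → Hᵏ(U)` is injective because
  `Hₖ(U) ≅ Hₖ(W_{k}) → Hₖ(M)` is onto (Milnor 1963, Thm. 3.1/3.5: `H_k(M, W_k) = 0`).

## References
* [Milnor1963] J. Milnor, *Morse theory*, Princeton UP 1963, §3 Thms. 3.1, 3.2, 3.5; §5.
* [MilnorHCobordism1965] J. Milnor, *Lectures on the h-cobordism theorem*, Princeton UP 1965,
  Def. 4.9, Thm. 4.8, Lemma 3.2, Cor. 3.15.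
* [HatcherAT2002] A. Hatcher, *Algebraic Topology*, CUP 2002, §3.1 Thm. 3.2, Cor. 2.11, 2.14.
* [LeeSmoothManifolds2013] J. M. Lee, *Introduction to Smooth Manifolds*, 2nd ed., Thm. 6.26.
-/

noncomputable section

open scoped Manifold ContDiff Topology
open CategoryTheory Set Function Module
open Literature.AlgebraicTopology.SingularHomology Literature.Topology.FourManifolds
open Literature.Topology.FourManifolds.Cobordism (cutLevel)

namespace Literature.Geometry.Manifold

variable (E : Type) [NormedAddCommGroup E] [NormedSpace ℝ E] (F : Type) [Field F]

/-- A **natural endomorphism of `Hᵏ(-; F)` on `E`-manifolds**: for every Hausdorff σ-compact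
`C^∞` manifold `M : Type` charted on `E` an `F`-linear endomorphism `app M` of `Hᵏ(M; F)`,
natural under `C^∞` maps: `app M (f^* x) = f^* (app N x)`. [folklore] -/
structure NaturalCohomologyEndo (k : ℕ) : Type 1 where
  /-- the endomorphism `ψ_M` of `Hᵏ(M; F)` -/
  app : ∀ (M : Type) [TopologicalSpace M] [ChartedSpace E M] [IsManifold 𝓘(ℝ, E) ∞ M]
    [T2Space M] [SigmaCompactSpace M], singularCohomology F F M k →ₗ[F] singularCohomology F F M k
  /-- naturality under `C^∞` maps -/
  naturality : ∀ (M : Type) [TopologicalSpace M] [ChartedSpace E M] [IsManifold 𝓘(ℝ, E) ∞ M]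
    [T2Space M] [SigmaCompactSpace M] (N : Type) [TopologicalSpace N] [ChartedSpace E N]
    [IsManifold 𝓘(ℝ, E) ∞ N] [T2Space N] [SigmaCompactSpace N] (f : M → N)
    (hf : ContMDiff 𝓘(ℝ, E) 𝓘(ℝ, E) ∞ f) (x : singularCohomology F F N k),
    app M (singularCohomology.map F F ⟨f, hf.continuous⟩ k x) =
      singularCohomology.map F F ⟨f, hf.continuous⟩ k (app N x)

namespace NaturalCohomologyEndo

variable {E F} {k : ℕ}

/-- Transfer along an injective pull-back: if `f : M → N` is `C^∞`, `f^*` is injective on `Hᵏ`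
and `ψ_M = r`, then `ψ_N = r`. [folklore] -/
theorem app_eq_smul_of_injective (ψ : NaturalCohomologyEndo E F k) {M N : Type}
    [TopologicalSpace M] [ChartedSpace E M] [IsManifold 𝓘(ℝ, E) ∞ M] [T2Space M]
    [SigmaCompactSpace M] [TopologicalSpace N] [ChartedSpace E N] [IsManifold 𝓘(ℝ, E) ∞ N]
    [T2Space N] [SigmaCompactSpace N] {f : M → N} (hf : ContMDiff 𝓘(ℝ, E) 𝓘(ℝ, E) ∞ f)
    (hinj : Injective (singularCohomology.map F F ⟨f, hf.continuous⟩ k)) {r : F}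
    (hM : ∀ y : singularCohomology F F M k, ψ.app M y = r • y) (x : singularCohomology F F N k) :
    ψ.app N x = r • x :=
  hinj (by rw [← ψ.naturality M N f hf x, hM, map_smul])

/-! ### Degree `0` -/

section DegreeZero

variable (E F) in
/-- `dim_F H⁰(E; F) = 1`: the model space is path connected. [cite: HatcherAT2002, Prop. 2.7 and Thm. 3.2] -/
theorem finrank_singularCohomology_model_zero :
    Module.finrank F (singularCohomology F F E 0) = 1 := by
  haveI : PathConnectedSpace E :=
    pathConnectedSpace_iff_univ.2 (convex_univ.isPathConnected univ_nonempty)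
  rw [finrank_singularCohomology_eq_bettiNumber_of_field]
  change Module.finrank F (singularHomology F F E 0) = 1
  rw [finrank_singularHomology_zero_of_pathConnectedSpace (R := F) (M := F)]
  exact Module.finrank_self F

variable [FiniteDimensional ℝ E]

/-- On a path-connected `E`-manifold `P`, a natural endomorphism of `H⁰` acts by the scalar by
which it acts on `H⁰(E; F)`: a constant map `E → P` is onto on `H₀`, hence injective on `H⁰`
(Hatcher 2002, Prop. 2.7, Thm. 3.2). [cite: HatcherAT2002, Prop. 2.7 and §3.1 Thm. 3.2] -/
theorem app_eq_smul_of_pathConnectedSpace (ψ : NaturalCohomologyEndo E F 0) {r : F}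
    (hr : ∀ y : singularCohomology F F E 0, ψ.app E y = r • y) (P : Type) [TopologicalSpace P]
    [ChartedSpace E P] [IsManifold 𝓘(ℝ, E) ∞ P] [T2Space P] [SigmaCompactSpace P]
    [PathConnectedSpace P] (w : singularCohomology F F P 0) : ψ.app P w = r • w := by
  obtain ⟨p⟩ := (inferInstance : Nonempty P)
  have hκ : ContMDiff 𝓘(ℝ, E) 𝓘(ℝ, E) ∞ (fun _ : E ↦ p) := contMDiff_const
  have hinj : Injective (singularCohomology.map F F ⟨fun _ : E ↦ p, hκ.continuous⟩ 0) :=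
    (singularCohomology_map_injective_iff_of_field F _ 0).2
      (surjective_map_zero_of_pathConnectedSpace F F _)
  apply hinj
  rw [← ψ.naturality E P _ hκ w, hr, map_smul]

/-- **Degree `0`**: a natural endomorphism of `H⁰(-; F)` on `E`-manifolds is a scalar on every
compact `E`-manifold (clopen additivity over the finitely many path components).
[cite: HatcherAT2002, Prop. 2.6, Prop. 2.7 and §3.1 Thm. 3.2] -/
theorem exists_eq_smul_of_zero (ψ : NaturalCohomologyEndo E F 0) :
    ∃ r : F, ∀ (M : Type) [TopologicalSpace M] [ChartedSpace E M] [IsManifold 𝓘(ℝ, E) ∞ M]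
      [T2Space M] [CompactSpace M] (x : singularCohomology F F M 0), ψ.app M x = r • x := by
  obtain ⟨r, hr⟩ := exists_apply_eq_smul_of_finrank_eq_one F
    (finrank_singularCohomology_model_zero E F) (ψ.app E)
  refine ⟨r, fun M _ _ _ _ _ x ↦ ?_⟩
  classical
  haveI : LocallyConnectedSpace M := ChartedSpace.locallyConnectedSpace E M
  haveI : LocallyPathConnectedSpace M := ChartedSpace.locallyPathConnectedSpace E M
  haveI : Fintype (ConnectedComponents M) := Fintype.ofFinite _
  let P : ConnectedComponents M → Set M := fun c ↦ ConnectedComponents.mk ⁻¹' {c}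
  have hPeq : ∀ y : M, P (ConnectedComponents.mk y) = connectedComponent y := fun y ↦
    connectedComponents_preimage_singleton
  have hPopen : ∀ c, IsOpen (P c) := fun c ↦ by
    obtain ⟨y, rfl⟩ := ConnectedComponents.surjective_coe c
    rw [hPeq]
    exact isOpen_connectedComponent
  have hP : IsClopenPartition P :=
    { isOpen := hPopen
      disjoint := fun j l hjl ↦ Disjoint.preimage _ (disjoint_singleton.2 hjl)
      exists_mem := fun z ↦ ⟨ConnectedComponents.mk z, rfl⟩ }
  rw [← sub_eq_zero, singularCohomology.eq_zero_iff_forall_map_subsetIncl hP]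
  intro c
  obtain ⟨y, rfl⟩ := ConnectedComponents.surjective_coe c
  let V : TopologicalSpace.Opens M := ⟨P (ConnectedComponents.mk y), hPopen _⟩
  haveI : PathConnectedSpace ↥V := by
    change PathConnectedSpace ↥(P (ConnectedComponents.mk y))
    rw [hPeq, ← pathComponent_eq_connectedComponent, ← isPathConnected_iff_pathConnectedSpace]
    exact isPathConnected_pathComponent
  haveI : CompactSpace ↥V := by
    change CompactSpace ↥(P (ConnectedComponents.mk y))
    rw [← isCompact_iff_compactSpace, hPeq]
    exact isClosed_connectedComponent.isCompact
  have hval : ContMDiff 𝓘(ℝ, E) 𝓘(ℝ, E) ∞ (Subtype.val : ↥V → M) := contMDiff_subtype_val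
  have h1 := ψ.naturality ↥V M Subtype.val hval x
  have h2 := app_eq_smul_of_pathConnectedSpace ψ hr ↥V (singularCohomology.map F F
    ⟨(Subtype.val : ↥V → M), hval.continuous⟩ 0 x)
  rw [map_sub, map_smul, sub_eq_zero]
  exact h1.symm.trans h2

end DegreeZero

/-! ### Vanishing above the dimension and in dimension `0` -/

section Vanishing

variable [FiniteDimensional ℝ E]

variable (E F) in
/-- If `dim E = 0`, an `E`-manifold is discrete and `Hⱼ(M; F) = 0` for `j ≠ 0`
(Hatcher 2002, Prop. 2.6, 2.8). [cite: HatcherAT2002, Prop. 2.6 and Prop. 2.8] -/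
theorem subsingleton_singularHomology_of_finrank_eq_zero (h0 : Module.finrank ℝ E = 0)
    (M : Type) [TopologicalSpace M] [ChartedSpace E M] {j : ℕ} (hj : j ≠ 0) :
    Subsingleton (singularHomology F F M j) := by
  haveI : Subsingleton E := Module.finrank_zero_iff.1 h0
  have hopen : ∀ x : M, IsOpen ({x} : Set M) := fun x ↦ by
    have hsub : (chartAt E x).source.Subsingleton := fun y hy z hz ↦
      (chartAt E x).injOn hy hz (Subsingleton.elim _ _)
    rw [← hsub.eq_singleton_of_mem (mem_chart_source E x)]
    exact (chartAt E x).open_source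
  haveI : DiscreteTopology M := ⟨eq_bot_of_singletons_open hopen⟩
  exact ModuleCat.subsingleton_of_isZero
    (isZero_singularHomology_of_totallyDisconnectedSpace (R := F) (M := F) hj)

variable (E F) in
/-- If `dim E = d + 1 < j`, then `Hⱼ(M; F) = 0` for every compact `E`-manifold `M`: after
re-charting `M` on `ℝᵈ⁺¹` it carries a Morse function, all of whose indices are `≤ d + 1`
(Milnor 1963, §5 with Thm. 3.5). [cite: Milnor1963, Thm. 3.5 and §5] -/
theorem subsingleton_singularHomology_of_finrank_lt {d : ℕ} (hd : Module.finrank ℝ E = d + 1)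
    (M : Type) [TopologicalSpace M] [ChartedSpace E M] [IsManifold 𝓘(ℝ, E) ∞ M] [T2Space M]
    [CompactSpace M] {j : ℕ} (hj : d + 1 < j) : Subsingleton (singularHomology F F M j) := by
  let L : E ≃L[ℝ] EuclideanSpace ℝ (Fin (d + 1)) :=
    ContinuousLinearEquiv.ofFinrankEq (by rw [hd, finrank_euclideanSpace_fin])
  have hL : ContMDiff 𝓘(ℝ, E) 𝓘(ℝ, EuclideanSpace ℝ (Fin (d + 1))) ∞ L.toHomeomorph :=
    Rechart.contMDiff_of_apply_eq_linear (I := 𝓘(ℝ, E)) L.toHomeomorph L fun _ ↦ rfl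
  have hL' : ContMDiff 𝓘(ℝ, EuclideanSpace ℝ (Fin (d + 1))) 𝓘(ℝ, E) ∞ L.toHomeomorph.symm :=
    Rechart.contMDiff_symm_of_apply_eq_linear (I := 𝓘(ℝ, E)) L.toHomeomorph L fun _ ↦ rfl
  haveI : IsManifold (𝓡 (d + 1)) ∞ (Rechart L.toHomeomorph M) := Rechart.isManifold _ M hL hL'
  haveI : SecondCountableTopology M := ChartedSpace.secondCountable_of_sigmaCompact E M
  haveI : SecondCountableTopology (Rechart L.toHomeomorph M) := ‹SecondCountableTopology M›
  obtain ⟨f, hf⟩ := exists_isMorse_holds (d + 1) (Rechart L.toHomeomorph M)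
  have h0 : Limits.IsZero (singularHomology F F (Rechart L.toHomeomorph M) j) :=
    IsMorse.isZero_singularHomology_of_forall_morseIndex_ne F F hf
      (fun a ↦ (isClosed_Iic.preimage hf.1.continuous).isCompact)
      (fun z _ ↦ ((morseIndex_le_finrank (𝓡 (d + 1)) f z).trans_lt
        (by rwa [finrank_euclideanSpace_fin])).ne)
  haveI := ModuleCat.subsingleton_of_isZero h0
  exact (injective_map_homeomorph F F (Rechart.outHomeomorph L.toHomeomorph M).symm j).subsingleton

omit [FiniteDimensional ℝ E] in
/-- If `Hₖ(M; F) = 0` then `ψ_M = r` on `Hᵏ(M; F) = 0` for any `r`. [folklore] -/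
theorem app_eq_smul_of_subsingleton (ψ : NaturalCohomologyEndo E F k) (M : Type)
    [TopologicalSpace M] [ChartedSpace E M] [IsManifold 𝓘(ℝ, E) ∞ M] [T2Space M]
    [SigmaCompactSpace M] [Subsingleton (singularHomology F F M k)] (r : F)
    (x : singularCohomology F F M k) : ψ.app M x = r • x := by
  rw [singularCohomology_eq_zero_of_subsingleton F k x, map_zero, smul_zero]

end Vanishing

/-! ### The test manifold `Sᵏ × ℝ^{d+1-k}` re-charted on `E` -/

section Test

variable [FiniteDimensional ℝ E] {d : ℕ}

/-- The cylinder `Sᵏ × ℝʲ`. [folklore] -/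
abbrev Cyl (k j : ℕ) : Type := ↥(unitSphere (k + 1)) × EuclideanSpace ℝ (Fin j)

variable (E k) in
omit [FiniteDimensional ℝ E] in
/-- `dim (ℝᵏ × ℝ^{d+1-k}) = dim E` when `dim E = d + 1` and `k ≤ d + 1`. [folklore] -/
theorem finrank_cylModel (hd : Module.finrank ℝ E = d + 1) (hk : k ≤ d + 1) :
    Module.finrank ℝ (EuclideanSpace ℝ (Fin k) × EuclideanSpace ℝ (Fin (d + 1 - k))) =
      Module.finrank ℝ E := by
  rw [Module.finrank_prod, finrank_euclideanSpace_fin, finrank_euclideanSpace_fin, hd]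
  omega

variable (E k) in
/-- A linear isomorphism `ℝᵏ × ℝ^{d+1-k} ≃L[ℝ] E`. [folklore] -/
def cylModelIso (hd : Module.finrank ℝ E = d + 1) (hk : k ≤ d + 1) :
    (EuclideanSpace ℝ (Fin k) × EuclideanSpace ℝ (Fin (d + 1 - k))) ≃L[ℝ] E :=
  ContinuousLinearEquiv.ofFinrankEq (finrank_cylModel E k hd hk)

variable (E k) in
/-- The same isomorphism as a change of model `ModelProd ℝᵏ ℝ^{d+1-k} ≃ₜ E`. [folklore] -/
def cylModelHomeomorph (hd : Module.finrank ℝ E = d + 1) (hk : k ≤ d + 1) :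
    ModelProd (EuclideanSpace ℝ (Fin k)) (EuclideanSpace ℝ (Fin (d + 1 - k))) ≃ₜ E :=
  (cylModelIso E k hd hk).toHomeomorph

/-- The change of model is `C^∞`. [folklore] -/
theorem contMDiff_cylModelHomeomorph (hd : Module.finrank ℝ E = d + 1) (hk : k ≤ d + 1) :
    ContMDiff ((𝓡 k).prod (𝓡 (d + 1 - k))) 𝓘(ℝ, E) ∞ (cylModelHomeomorph E k hd hk) :=
  Rechart.contMDiff_of_apply_eq_linear _ (cylModelIso E k hd hk) fun _ ↦ rfl

/-- The inverse change of model is `C^∞`. [folklore] -/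
theorem contMDiff_cylModelHomeomorph_symm (hd : Module.finrank ℝ E = d + 1) (hk : k ≤ d + 1) :
    ContMDiff 𝓘(ℝ, E) ((𝓡 k).prod (𝓡 (d + 1 - k))) ∞ (cylModelHomeomorph E k hd hk).symm :=
  Rechart.contMDiff_symm_of_apply_eq_linear _ (cylModelIso E k hd hk) fun _ ↦ rfl

variable (E k) in
/-- **The test manifold** `Q = Sᵏ × ℝ^{d+1-k}` re-charted on `E` (`dim E = d + 1`, `k ≤ d + 1`).
[folklore] -/
abbrev Test (hd : Module.finrank ℝ E = d + 1) (hk : k ≤ d + 1) : Type :=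
  Rechart (cylModelHomeomorph E k hd hk) (Cyl k (d + 1 - k))

/-- The test manifold is a `C^∞` `E`-manifold (a local instance in this file). [folklore] -/
theorem isManifold_test (hd : Module.finrank ℝ E = d + 1) (hk : k ≤ d + 1) :
    IsManifold 𝓘(ℝ, E) ∞ (Test E k hd hk) :=
  Rechart.isManifold _ _ (contMDiff_cylModelHomeomorph hd hk) (contMDiff_cylModelHomeomorph_symm hd hk)

attribute [local instance] isManifold_test

variable (F) in
/-- `dim_F Hᵏ(Q; F) = 1` for the test manifold (`k ≥ 1`). [cite: HatcherAT2002, Cor. 2.14 and §3.1 Thm. 3.2] -/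
theorem finrank_singularCohomology_test (hd : Module.finrank ℝ E = d + 1) (hk : k ≤ d + 1)
    (hk1 : 1 ≤ k) : Module.finrank F (singularCohomology F F (Test E k hd hk) k) = 1 := by
  rw [← (singularCohomology.mapIso F F
    (Rechart.outHomeomorph (cylModelHomeomorph E k hd hk) (Cyl k (d + 1 - k))) k).toLinearEquiv.finrank_eq]
  exact finrank_singularCohomology_sphereCylinder F k (d + 1 - k) hk1

variable (F) in
/-- **Smoothing the collapse map into the test manifold.** For a σ-compact `E`-manifold `U` and a
continuous `γ : U → OnePoint ℝᵏ` (`k ≥ 1`) there is a `C^∞` map `G : U → Q` such that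
`G_* σ ≠ 0` whenever `γ_* σ ≠ 0` (`σ ∈ Hₙ(U; F)`): Whitney-approximate `θ ∘ γ : U → Sᵏ`
(Lee 2013, Thm. 6.26) and follow with the zero section. [cite: LeeSmoothManifolds2013, Thm. 6.26] -/
theorem exists_contMDiff_test (hd : Module.finrank ℝ E = d + 1) (hk : k ≤ d + 1)
    (U : Type) [TopologicalSpace U] [ChartedSpace E U] [IsManifold 𝓘(ℝ, E) ∞ U]
    [SigmaCompactSpace U] [T2Space U] (γ : C(U, OnePoint (EuclideanSpace ℝ (Fin k)))) :
    ∃ (G : U → Test E k hd hk) (hG : ContMDiff 𝓘(ℝ, E) 𝓘(ℝ, E) ∞ G),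
      ∀ (n : ℕ) (σ : singularHomology F F U n), singularHomology.map F F γ n σ ≠ 0 →
        singularHomology.map F F ⟨G, hG.continuous⟩ n σ ≠ 0 := by
  obtain ⟨G₀, hG₀, hhom⟩ := exists_contMDiff_homotopic (IM := 𝓘(ℝ, E)) (IN := 𝓡 k)
    ((⟨onePointHomeomorphUnitSphere k, (onePointHomeomorphUnitSphere k).continuous⟩ :
      C(OnePoint (EuclideanSpace ℝ (Fin k)), ↥(unitSphere (k + 1)))).comp γ)
  have hincl : ContMDiff (𝓡 k) ((𝓡 k).prod (𝓡 (d + 1 - k))) ∞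
      (sphereCylinderIncl k (d + 1 - k)) := contMDiff_id.prodMk contMDiff_const
  have hG : ContMDiff 𝓘(ℝ, E) 𝓘(ℝ, E) ∞
      (fun u ↦ Rechart.into (cylModelHomeomorph E k hd hk) _ (sphereCylinderIncl k (d + 1 - k) (G₀ u))) :=
    (Rechart.contMDiff_into _ _ (contMDiff_cylModelHomeomorph hd hk)
      (contMDiff_cylModelHomeomorph_symm hd hk)).comp (hincl.comp hG₀)
  refine ⟨_, hG, fun n σ hσ h0 ↦ ?_⟩
  have hne := map_sphereCylinderIncl_comp_ne_zero F F (j := d + 1 - k) γ G₀ hhom.symm hσ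
  apply hne
  apply injective_map_homeomorph F F
    (Rechart.outHomeomorph (cylModelHomeomorph E k hd hk) (Cyl k (d + 1 - k))).symm n
  rw [map_zero, ← ModuleCat.comp_apply, ← singularHomology.map_comp]
  exact h0

end Test

attribute [local instance] isManifold_test

/-! ### Degrees `1 ≤ k ≤ dim E`: the handlebody of a nice Morse function -/

section Handlebody

variable [FiniteDimensional ℝ E] {d : ℕ}

variable (d) in
/-- The identity of `M` onto the total space of the cobordism `(X; ∅, ∅)`, where `X` is `M`
re-charted on `ℝᵈ⁺¹` along `f : E ≃ₜ ℝᵈ⁺¹` (all the type synonyms involved carry the topology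
of `M`). [folklore] -/
def toW (f : E ≃ₜ EuclideanSpace ℝ (Fin (d + 1))) (M : Type) [TopologicalSpace M]
    [ChartedSpace E M] [IsManifold (𝓡 (d + 1)) ∞ (Rechart f M)] [T2Space M] [CompactSpace M]
    [SecondCountableTopology (Rechart f M)] :
    M ≃ₜ (Cobordism.ofClosed d (Rechart f M)).W where
  toFun x := HalfSpaceCharted.of (Rechart.into f M x)
  invFun z := Rechart.out f M (HalfSpaceCharted.of.symm z)
  left_inv _ := rfl
  right_inv _ := rfl
  continuous_toFun := Rechart.continuous_into f M
  continuous_invFun := Rechart.continuous_out f M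

/-- The open subset `τ ⁻¹' {g < b}` of `M`. [folklore] -/
def sublevelOpens {M W : Type} [TopologicalSpace M] [TopologicalSpace W] (τ : M ≃ₜ W)
    {g : W → ℝ} (hg : Continuous g) (b : ℝ) : TopologicalSpace.Opens M :=
  ⟨τ ⁻¹' {z | g z < b}, (isOpen_lt hg continuous_const).preimage τ.continuous⟩

variable (F) in
/-- **Degrees `1 ≤ k ≤ dim E`.** If `ψ` acts by `r` on `Hᵏ` of the test manifold
`Q = Sᵏ × ℝ^{d+1-k}`, it acts by `r` on `Hᵏ(M; F)` for every compact `E`-manifold `M`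
(`dim E = d + 1`): Morse theory on `M` re-charted on `ℝᵈ⁺¹` (module docstring).
[cite: Milnor1963, Thm. 3.1, 3.2, 3.5] [cite: MilnorHCobordism1965, Thm. 4.8, Lemma 3.2, Cor. 3.15]
[cite: HatcherAT2002, §3.1 Thm. 3.2] -/
theorem app_eq_smul_of_pos (ψ : NaturalCohomologyEndo E F k) (hk1 : 1 ≤ k)
    (hd : Module.finrank ℝ E = d + 1) (hkd : k ≤ d + 1) {r : F}
    (hr : ∀ y : singularCohomology F F (Test E k hd hkd) k, ψ.app (Test E k hd hkd) y = r • y)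
    (M : Type) [TopologicalSpace M] [ChartedSpace E M] [IsManifold 𝓘(ℝ, E) ∞ M] [T2Space M]
    [CompactSpace M] (x : singularCohomology F F M k) : ψ.app M x = r • x := by
  classical
  -- ### re-charting `M` on `ℝᵈ⁺¹`
  let L : E ≃L[ℝ] EuclideanSpace ℝ (Fin (d + 1)) :=
    ContinuousLinearEquiv.ofFinrankEq (by rw [hd, finrank_euclideanSpace_fin])
  have hL : ContMDiff 𝓘(ℝ, E) 𝓘(ℝ, EuclideanSpace ℝ (Fin (d + 1))) ∞ L.toHomeomorph :=
    Rechart.contMDiff_of_apply_eq_linear (I := 𝓘(ℝ, E)) L.toHomeomorph L fun _ ↦ rfl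
  have hL' : ContMDiff 𝓘(ℝ, EuclideanSpace ℝ (Fin (d + 1))) 𝓘(ℝ, E) ∞ L.toHomeomorph.symm :=
    Rechart.contMDiff_symm_of_apply_eq_linear (I := 𝓘(ℝ, E)) L.toHomeomorph L fun _ ↦ rfl
  haveI : IsManifold (𝓡 (d + 1)) ∞ (Rechart L.toHomeomorph M) := Rechart.isManifold _ M hL hL'
  haveI : SecondCountableTopology M := ChartedSpace.secondCountable_of_sigmaCompact E M
  haveI : SecondCountableTopology (Rechart L.toHomeomorph M) := ‹SecondCountableTopology M›
  -- ### a nice Morse function and a gradient-like vector field on `(X; ∅, ∅)`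
  obtain ⟨f₀, hf₀⟩ := exists_isMorse_holds (d + 1) (Rechart L.toHomeomorph M)
  obtain ⟨f₁, hf₁, hsi, -, -⟩ :=
    exists_isSelfIndexing_criticalSet_eq_holds (d + 1) (Rechart L.toHomeomorph M) f₀ hf₀
  obtain ⟨g, hg⟩ : ∃ g : (Cobordism.ofClosed d (Rechart L.toHomeomorph M)).W → ℝ,
      (Cobordism.ofClosed d (Rechart L.toHomeomorph M)).IsNiceMorseFunction g :=
    ⟨_, (IsSelfIndexing.isNiceMorseFunction_ofClosed hf₁ hsi).1⟩
  obtain ⟨ξ, hξ⟩ := Cobordism.Milnor1965_exists_isGradientLike_holds hg.isMorseFunction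
  have hgM := hg.isMorseFunction
  have hgc : Continuous g := hgM.isMorse.contMDiff.continuous
  -- `g` read on `X`, regularity of the cut level
  let f : Rechart L.toHomeomorph M → ℝ := fun y ↦ g (HalfSpaceCharted.of y)
  have hfg : f ∘ ⇑HalfSpaceCharted.of.symm = g := rfl
  have hfM : IsMorse (𝓡 (d + 1)) f := HalfSpaceCharted.isMorse_iff.1 (hfg ▸ hgM.isMorse)
  have hfs : ContMDiff (𝓡 (d + 1)) 𝓘(ℝ, ℝ) ∞ f := hfM.contMDiff
  have hcritf : ∀ y, IsMCriticalPt (𝓡 (d + 1)) f y →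
      HalfSpaceCharted.of y ∈ criticalSet (𝓡∂ (d + 1)) g :=
    fun y hy ↦ (HalfSpaceCharted.isMCriticalPt_iff' (f := f) (q := HalfSpaceCharted.of y)).2 hy
  have hregb : ∀ y, f y = cutLevel d (k + 1) → mfderiv (𝓡 (d + 1)) 𝓘(ℝ, ℝ) f y ≠ 0 := by
    intro y hy hd'
    exact hg.apply_ne_cutLevel (hcritf y hd') (k + 1) hy
  -- ### the handlebody `U = {g < cut_{k+1}}` as an open subset of `M`
  let τ : M ≃ₜ (Cobordism.ofClosed d (Rechart L.toHomeomorph M)).W := toW d L.toHomeomorph M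
  let Uo : TopologicalSpace.Opens M := sublevelOpens τ hgc (cutLevel d (k + 1))
  haveI : LocallyCompactSpace ↥Uo := Uo.2.locallyCompactSpace
  have hval : ContMDiff 𝓘(ℝ, E) 𝓘(ℝ, E) ∞ (Subtype.val : ↥Uo → M) := contMDiff_subtype_val
  -- ### (A) `ψ_U = r` on `Hᵏ(U; F)`
  have hU : ∀ y : singularCohomology F F ↥Uo k, ψ.app ↥Uo y = r • y := by
    let S : Submodule F (singularCohomology F F ↥Uo k) :=
      LinearMap.ker (ψ.app ↥Uo - r • LinearMap.id)
    suffices hS : S = ⊤ by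
      intro y
      have hy : y ∈ S := hS ▸ Submodule.mem_top
      simpa only [S, LinearMap.mem_ker, LinearMap.sub_apply, LinearMap.smul_apply,
        LinearMap.id_apply, sub_eq_zero] using hy
    haveI : Module.Finite F (singularHomology F F ↥Uo k) :=
      hg.finite_singularHomology_sublevel_lt F ξ hξ hk1 hkd
    refine submodule_eq_top_of_kroneckerPairing F k S fun σ hσ ↦ ?_
    by_contra hσ0
    -- the detection data at the critical points of index `k`, and a detecting collapse map
    let Δ : ∀ p : ↥(criticalSetOfIndex (𝓡∂ (d + 1)) g k),
        Cobordism.DetectionDatum (Cobordism.ofClosed d (Rechart L.toHomeomorph M)) g (⇑ξ) k p :=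
      fun p ↦ Classical.choice (hg.nonempty_detectionDatum ξ hξ hkd p.2)
    obtain ⟨p, hp⟩ := hg.exists_map_collapse_ne_zero F ξ hξ hk1 hkd Δ σ hσ0
    -- the collapse map read on the open subset `U` of `M` (same space)
    let γ : C(↥Uo, OnePoint (EuclideanSpace ℝ (Fin k))) := ⟨fun u ↦ (Δ p).map u, (Δ p).map.continuous⟩
    have hγ : singularHomology.map F F γ k σ ≠ 0 := hp
    -- a smooth map into the test manifold detecting `σ`
    obtain ⟨G, hG, hGne⟩ := exists_contMDiff_test F hd hkd ↥Uo γ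
    obtain ⟨v, hv⟩ := exists_kroneckerPairing_ne_zero F k (hGne k σ hγ)
    apply hv
    rw [← kroneckerPairing_map]
    apply hσ
    simp only [S, LinearMap.mem_ker, LinearMap.sub_apply, LinearMap.smul_apply,
      LinearMap.id_apply, sub_eq_zero]
    rw [ψ.naturality ↥Uo (Test E k hd hkd) G hG v, hr, map_smul]
  -- ### (B) `Hᵏ(M) → Hᵏ(U)` is injective: `Hₖ(U) ≅ Hₖ(W_{k}) → Hₖ(M)` is onto
  have hsurjW : Surjective (singularHomology.map F F
      (subsetIncl {z : (Cobordism.ofClosed d (Rechart L.toHomeomorph M)).W |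
        g z < cutLevel d (k + 1)}) k) := by
    have h1 := hg.surjective_map_subsetIncl_cutLevel F F k
    have h2 := bijective_map_inclusion_sublevel_lt F F hfs hregb k
    have hcomp : subsetIncl {z : (Cobordism.ofClosed d (Rechart L.toHomeomorph M)).W |
          g z < cutLevel d (k + 1)} =
        (subsetIncl {z : (Cobordism.ofClosed d (Rechart L.toHomeomorph M)).W |
          g z ≤ cutLevel d (k + 1)}).comp
          ⟨fun u ↦ ⟨u.1, (show g u.1 < cutLevel d (k + 1) from u.2).le⟩,
            continuous_subtype_val.subtype_mk _⟩ := rfl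
    rw [hcomp, singularHomology.map_comp]
    intro z
    obtain ⟨y, hy⟩ := h1 z
    obtain ⟨w, hw⟩ := h2.2 y
    refine ⟨w, ?_⟩
    rw [ModuleCat.comp_apply]
    exact (congrArg (singularHomology.map F F (subsetIncl
      {z : (Cobordism.ofClosed d (Rechart L.toHomeomorph M)).W | g z ≤ cutLevel d (k + 1)}) k) hw).trans hy
  have hinj : Injective (singularCohomology.map F F
      ⟨(Subtype.val : ↥Uo → M), hval.continuous⟩ k) := by
    rw [singularCohomology_map_injective_iff_of_field]
    exact hsurjW
  -- ### conclusion
  exact app_eq_smul_of_injective ψ hval hinj hU x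

end Handlebody

/-! ### The theorem -/

/-- **Natural endomorphisms of `Hᵏ(-; F)` on `E`-manifolds are scalars on compact manifolds**:
for every natural endomorphism `ψ` of `Hᵏ(-; F)` on Hausdorff σ-compact `C^∞` `E`-manifolds
there is `r : F` with `ψ_M = r • id` for all compact `M` (module docstring: Morse theory,
Pontryagin–Thom collapse of the handles, Kronecker duality). [cite: Milnor1963, Thm. 3.5 and §5]
[cite: MilnorHCobordism1965, Thm. 4.8, Lemma 3.2, Cor. 3.15] [cite: HatcherAT2002, §3.1 Thm. 3.2, Cor. 2.14] -/
theorem exists_eq_smul [FiniteDimensional ℝ E] (ψ : NaturalCohomologyEndo E F k) :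
    ∃ r : F, ∀ (M : Type) [TopologicalSpace M] [ChartedSpace E M] [IsManifold 𝓘(ℝ, E) ∞ M]
      [T2Space M] [CompactSpace M] (x : singularCohomology F F M k), ψ.app M x = r • x := by
  rcases Nat.eq_zero_or_pos k with rfl | hk1
  · exact exists_eq_smul_of_zero ψ
  rcases hd : Module.finrank ℝ E with _ | d
  · refine ⟨0, fun M _ _ _ _ _ x ↦ ?_⟩
    haveI := subsingleton_singularHomology_of_finrank_eq_zero E F hd M (Nat.pos_iff_ne_zero.1 hk1)
      (j := k)
    exact app_eq_smul_of_subsingleton ψ M 0 x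
  by_cases hkd : k ≤ d + 1
  · obtain ⟨r, hr⟩ := exists_apply_eq_smul_of_finrank_eq_one F
      (finrank_singularCohomology_test F hd hkd hk1) (ψ.app (Test E k hd hkd))
    exact ⟨r, fun M _ _ _ _ _ x ↦ app_eq_smul_of_pos F ψ hk1 hd hkd hr M x⟩
  · refine ⟨0, fun M _ _ _ _ _ x ↦ ?_⟩
    haveI := subsingleton_singularHomology_of_finrank_lt E F hd M (lt_of_not_ge hkd)
    exact app_eq_smul_of_subsingleton ψ M 0 x

end NaturalCohomologyEndo

end Literature.Geometry.Manifold
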